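import Summits.AtomisticToContinuum.Crystallization.Theorems.ChargedEnergyGapSeamTransfer
import HarnessLib

/-!
(SPLIT FOR THE 400-LINE CAP by the landing lane, hand-2 g29: this file = part A; part B = `…ChargedEnergyGapLocalTransfer` imports it; same namespace, all FQNs unchanged.)
# `ChargedEnergyGap` — the LOCALISED TRANSFER BOUND: product localisation factors, χ-weighted shell and transition masses, localised pricing
LANDING BANNER (critic row 1115 (6); landing lane hand-2 g31): the (H𝄪)/(N𝄪)-type RECORD pieces of this lens-3 g53–g56 engine are VACUOUS at μ₀ > 0 — `harmStableWith_nonpos` (lens-3 g61, `…ChargedEnergyGapRotationGauge`); superseded by the …R designate ((H𝄪ʳ) `LocalSeamTransferBoundR`, (N𝄪ʳ) `LocalSeamReductionR` of `…ChargedEnergyGapRotationRepair`).  Landed as an ENGINE: the transfer / reduction lemmas below are consumed by P-I.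
# (cell `decomp-a2c`, lens 3, generation 56, node «LocalisedTransfer», part P-D; over part P-C `…Theorems.ChargedEnergyGapSeamTransfer`)

WHAT P-C LEFT IDEA-NEEDED (memo g55 §3, critic row 1062: node accepted in principle, «open on two levers: (L1) the budget table of the
χ-switch, (L2) the tip/contact lemma»).  The seam reduction (Nˢ) serves, grain by grain, every clean far component that is ONE Barlow
orientation up to first-generation Σ3 twins (slot ratio `q_fict/q_true = 1.6 < 1/λ = 2` at a coherent twin face, memo g55 A1); it does
NOT serve a NETWORK of `≥ 3` mutually rotated twin variants (Σ3ⁿ chains, cyclic and polysynthetic twins, twin cells): relative to any ONE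
reference a second-generation variant has scrambled slots, and coherent faces cannot be excised for free.  The physical budget exists
(every layer of Barlow matter carries `3.63·10⁻⁵·w` per site and per STAGGERED SIDE above `e*` — `7.27·10⁻⁵·w` in fcc interiors, one side
next to a twin plane or a fault, converged layer table of census C16-31 (c); hcp admits no inclined twins) and wants a transfer bound
LOCALISED to regions that one reference serves.

THE ANALYSIS (memo g56 §1–§4).  Multiply the far weight `w` by a LOCALISATION FACTOR `χ = ∏ᵢ (σᵢ ? w_{ϱχ, Dᵢ} : 1 − w_{ϱχ, Dᵢ})` — a
product of profile weights (the lineage's only weight shape) of ARBITRARY `Λ_P`-invariant sets `Dᵢ` at the scale `ϱχ`, with a sign pattern `σ`.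
The Cauchy–Schwarz split of the transfer cost of `ω = χ·w` (memo §1: per site `≈ |∇³ω|²/(λμ)`, the `∇ω` and `∇²ω` ghost forces being
killed by the zero virial stress and by centrosymmetry / the hcp optical response) is `χ·(cost of w) + w·(cost of χ) + cross terms`, so
the honest prices are: `C_T` per unit of χ-WEIGHTED SHELL MASS `Σ_{shell} χ` (never more than the plain shell count), and `Cχ` per unit of
w-WEIGHTED TRANSITION MASS `Σ w·alive_σ·mult²` — `mult(y)` the number of listed sets whose profile is strictly between `0` and `1` at `y`
(Cauchy–Schwarz over coincident transitions: the adversary may align them), `alive_σ(y) ∈ {0, 1}` the product of the pattern's factors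
NOT in transition (a pattern whose weight vanishes near `y` for the trivial reason pays nothing there; a pattern-independent mass would
charge each of the `2^m` patterns).  Pricing is LOCALISED with the weight: an excised site is priced only within `3ϱ/8` of a non-excised
site with `χ·w > 0`, so each instance excises everything farther than `3ϱ/8` from ITS support for free.  The sum over all `2^m` sign
patterns of `χ_σ` is `1` (`localFactor_snoc_add`, induction on the list): the instances of the reduction are a partition of unity.

(L1) THE BUDGET TABLE (memo §2).  χ-switch cost per transition site `c(L) = C₀·(80/L)⁴` at transition width `L = ϱχ/2` (third-moment law;
`C₀ = 1.56·10⁻⁷` from census C11-29 scaled to `λ = 1/2`, or `3.33·10⁻⁷ = C_T` budgeted): `L = 40 → 2.5·10⁻⁶ / 5.3·10⁻⁶`;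
`L = 25 → 1.6·10⁻⁵ / 3.5·10⁻⁵`; `L = 20 → 4.0·10⁻⁵ / 8.5·10⁻⁵`; `L = 10 → 6.4·10⁻⁴ / 1.4·10⁻³`; self-paying threshold against the one-sided
layer surplus `3.63·10⁻⁵`: `L₀ = 20.5 / 24.8` (the critic's `L⁻²` envelope gives `L₀ ≈ 7.7`; the `L⁻⁴` law is the conservative one).
Record `(ϱχ, Cχ) = (80, 10⁻⁵)`: `×4 / ×1.9` above `c(40)`, and the two patterns sharing a simple transition zone pay
`2Cχ·w = 2·10⁻⁵·w < 3.63·10⁻⁵·w` (`×1.8` against ONE staggered side; `×3.6` against the fcc interior `7.27·10⁻⁵·w`).  The scale is pinned from above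
by the PROXIMITY LEMMA (two carved orientation classes that are not Σ3-related are `≥ 160/√3 = 92.4` apart, so the transition zone
`(ϱχ/2, ϱχ)` around a class stays `≥ 12` clear of every class its reference does not serve iff `ϱχ ≤ 80`) and from below by `c(L)`.
Payers: (α) the c-surplus, GLOBAL (domain interiors pay for zones); (β) the existential debit within `R₁` of other-gross matter; (γ)
`w = 0` within `ϱ/2` of core orbits; (δ) at polyhedral corners of twin cells (multiplicity `2–4`, within `139` of cored cell edges,
`w ≤ 0.46`) the MIN-ASSIGNMENT price `P(m) = Σ_{k≤m} k² + m² = 0, 2, 9, 23, 46` is paid by the CORE SLACK `c₁/3` of the cored edge (corner w-mass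
`≤ 68` site units per unit edge length with the tree's septic profile ⇒ `0.4` core sites per unit edge length suffice even at `P = 9`);
over random class orders the dihedral mean `11/3·Cχ` is also below the fcc-interior surplus.
(L2) THE EDGE / TIP / CONTACT LEMMA (memo §3).  Around a gross-free edge the cyclic sequence of orientations is a closed walk in the Σ3ⁿ
TREE (`m_A m_B ≠ m_B m_A` for distinct {111} mirrors), a backtrack `O_{i−1} = O_{i+1}` forces the two faces of `O_i` into one plane, so
there is no edge: in gross-free labelled matter every coherent face is a complete plane; tips ({112} incoherent Σ3 walls), face edges
(`≥ 3` orientations ⇒ incoherent within `40` ⇒ CORED once charged and uncharted) and Σ9 contacts are gross — physical input (census ask GROSS-56).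
Consequence (WEDGE-CROSSING LEMMA, plane geometry): a segment of length `< 92` whose endpoints are `> 80` from gross matter never crosses
two non-parallel faces of one domain consecutively, so along it all faces are parallel and at most two orientations occur — every alive
pattern at a weighted site admits ANY of its classes as reference, and the residual (γ′) of P-C is DISCHARGED into (N𝄪)'s scope.

THE TWO MOVES (no new datum kind, no new currency; one new dial pair `(ϱχ, Cχ)`).
 (1) PRODUCT LOCALISATION.  `localFactor ϱχ D σ`, `transMult`, `aliveFactor`; `shellMassL` (χ-weighted shell mass), `transMassL`
     (w-weighted alive transition mass × mult²), `modelFarL` (the P-A model with weights `χ·w`).  With the EMPTY list (`m = 0`) every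
     factor is `1`: `shellMassL = modelShellCount`, `transMassL = 0`, `modelFarL = modelFar` — (H𝄪) at `m = 0` is (Hˢ) VERBATIM.
 (2) LOCALISED PRICING.  `pricedNearCountL`: excised sites within `3ϱ/8` of a non-excised site with `χ·w > 0`; `≤ pricedNearCount`
     (`pricedNearCountL_le`), `=` at `m = 0`.

THE SPLIT (modus ponens, re-glued; generic in `W`; dials of P-C plus `ϱχ Cχ`):
  (H𝄪) LOCAL-TRANSFER(C_T, Cχ, ϱχ)  `LocalSeamTransferBoundC s lam ℓ μ₀ τ λ ϱ b₀ r_S C_T ϱχ Cχ` — (Hˢ) for the weights `χ·w` with the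
                           two masses priced and the localised pricing · STRONGER than (Hˢ) (`seamTransferBoundC_of_local`, `m = 0`), hence
                           than (H♯) (`b₀ ≤ s`), (H♭), (H) · UNDECIDED → TRUE-leaning (memo §2: the new test data are product weights of
                           width `≥ ϱχ/2 = 40`, priced at `×1.9–×4` their third-moment cost; Λ-invariance of the `Dᵢ` is load-bearing — a
                           non-invariant half-space makes `χ|motif` a sawtooth with an unpriced jump, FALSE; `ϱχ → 0` is FALSE (sharp
                           walls, dead end (xxii)); kill sign: per-transition-site optimum of the C11 engine at width `40`, `λ = 1/2`, above
                           `10⁻⁵`, census ask χCOST-56) · INSTRUMENTABLE (χCOST-56; VOLT31 PASSED for (Hˢ)) · ATTACKABLE-M+ (P-B's programme + the product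
                           rule);
  (N𝄪) LOCAL-REDUCTION_W   `LocalSeamReductionW … W c₁ ρ₀ B₀` := (H𝄪) ⟹ CB-FAR_W|cored,B₀ — WEAKER than (Nˢ)
                           (`localSeamReductionW_of_seamReduction`), than (N♯) (`b₀ ≤ s`), (N♭), the leaf · UNDECIDED (TRUE-leaning with
                           the leaf) · ATTACKABLE-L on EVERY clean labelled far component of a Barlow TWIN NETWORK of any generation
                           structure (memo §4: sets = carved orientation classes, min-assignment instances `n_O·∏_{U<O} f_U`, references
                           by the wedge-crossing lemma, payers (α)–(δ)), with arbitrary stacking-seam and centred dislocation content and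
                           priced holes as in (Nˢ) · residual: (ε) charted-charged coherent misoriented walls, if LJ has any (census
                           C16 (d)); physical inputs χCOST-56 (cost law at width 40) and GROSS-56 (grossness of tips, edges, Σ9 contacts, fivefold
                           axes at `θ = 3/20`);
  glue (proved)            (H𝄪) ∧ (N𝄪) ⟹ CB-FAR_W|cored,B₀ (`farLabelledFloorCoredBudgetW_of_local`).
WHY THIS IS NOVEL.  Multi-variant twin networks enter an atomistic energy-account inequality not through a second chart, an orientation
field or a grain-boundary energy, but through a PARTITION OF UNITY BY PRODUCTS OF THE SAME PROFILE WEIGHT, each instance priced by two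
masses that the Cauchy–Schwarz split of the transfer cost makes honest (χ-weighted shell mass, w-weighted alive transition mass × mult²),
with the geometry of twin networks (Σ3ⁿ tree ⇒ no gross-free edges ⇒ wedge-crossing ⇒ proximity `160/√3`) fixing the one admissible
scale window `ϱχ ∈ [50, 89]`.  Searched: corpus (fts + vec) and galaxy for «partition of unity atomistic to continuum | localisation
Cauchy–Born | blended quasicontinuum ghost force», «multiple twinning Σ3ⁿ tree | cyclic twin fivefold | coincidence site lattice
combination rule», «twin junction disclination energy»: blending-function consistency analyses (Li–Luskin–Ortner–Shapeev 2012–14,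
arXiv:1304.5026), Σ3ⁿ combination rule and the twin tree (Reed–Kumar et al., doi:10.1080/14786430412331315707), fivefold-twin
disclinations (de Wit 1972) — no weighted-account bound localised by profile products with transition pricing.

§1 Localisation factors, transition multiplicity, alive indicator; ★ partition (`snoc`), bounds, the four `m = 0` identities; the masses,
the localised model and pricing, ★ `pricedNearCountL ≤ pricedNearCount`.  §2 The two pieces; ★ (H𝄪) ⟹ (Hˢ) ⟹ (H♯) ⟹ (H♭) ⟹ (H);
(Nˢ) ⟹ (N𝄪); glue; WEAKER; dials incl. `Cχ`.  §3 Record `(ϱχ, Cχ) = (80, 10⁻⁵)`: ★★ the ten-leaf cone for every `W`, ★★ the max-cover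
cone at `ϱ = 160`, the P-C cone recovered, the budget-table arithmetic (L1), the proximity and free-excision numerals.

TAGS.  LOCAL-TRANSFER(1/(3·10⁶), 10⁻⁵, 80): UNDECIDED→TRUE-leaning · INSTRUMENTABLE (χCOST-56 new; VOLT31 inherited) · ATTACKABLE-M+ ·
STRONGER than (Hˢ) (proved).  LOCAL-REDUCTION_W: WEAKER than SEAM-REDUCTION_W, VOLTERRA-, HARM-REDUCTION_W and CB-FAR_W|cored,10⁵ (all
proved) · UNDECIDED · ATTACKABLE-L (twin networks of any generation structure; scope = (Nˢ)'s plus the discharged (γ′)) | residual (ε) and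
the physical inputs χCOST-56 / GROSS-56.  No new EQUIV (the lineage's EQUIV of record stays `farLabelledFloorCoredW_iff_budget_packing`, part O-D).
The dial pair is load-bearing: `Cχ` below `c(ϱχ/2)` or `ϱχ → 0` make LOCAL-TRANSFER false, `ϱχ > 89` makes LOCAL-REDUCTION unservable. -/

noncomputable section

open scoped Classical
open Literature.MathematicalPhysics.StatisticalMechanics
open Literature.Geometry.DiscreteGeometry
open Summit.AtomisticToContinuum.Crystallization.Theses.PricedLinkCensus
open Summit.AtomisticToContinuum.Crystallization.Theorems.ChargedEnergyGapNegative

namespace Summit.AtomisticToContinuum.Crystallization.Theorems.ChargedEnergyGapChartDial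

/-! ## §1 Localisation factors, the masses, the localised model and the localised pricing -/

section Local

variable (ϱχ : ℝ) {m : ℕ} (D : Fin m → Set E3) (σ : Fin m → Bool)

/-- The **LOCALISATION FACTOR** of the set list `D` with sign pattern `σ` at scale `ϱχ`: the product over the list of the profile weight
`w_{ϱχ, Dᵢ}` («far from `Dᵢ`»: `0` within `ϱχ/2`, `1` beyond `ϱχ`) where `σᵢ = true` and of its complement `1 − w_{ϱχ, Dᵢ}`
(«near `Dᵢ`») where `σᵢ = false`.  Summed over all sign patterns it is `1` (`localFactor_snoc_add`). -/
def localFactor (y : E3) : ℝ :=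
  ∏ i, if σ i then profileWeight ϱχ (D i) y else 1 - profileWeight ϱχ (D i) y

/-- The `i`-th listed set is IN TRANSITION at `y`: its profile weight lies strictly between `0` and `1` (`ϱχ/2 < dist(y, Dᵢ) < ϱχ`). -/
def InTransition (i : Fin m) (y : E3) : Prop :=
  0 < profileWeight ϱχ (D i) y ∧ profileWeight ϱχ (D i) y < 1

/-- The TRANSITION MULTIPLICITY at `y`: the number of listed sets in transition there (coincident transitions counted with multiplicity —
the Cauchy–Schwarz factor of aligned switches). -/
def transMult (y : E3) : ℕ :=
  (Finset.univ.filter fun i => InTransition ϱχ D i y).card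

/-- The ALIVE INDICATOR of the pattern `σ` at `y`: the product of its factors that are NOT in transition at `y` (each `0` or `1`), the
factors in transition replaced by `1` — it vanishes iff the pattern's weight vanishes near `y` for the trivial reason. -/
def aliveFactor (y : E3) : ℝ :=
  ∏ i, if InTransition ϱχ D i y then 1 else (if σ i then profileWeight ϱχ (D i) y else 1 - profileWeight ϱχ (D i) y)

variable {ϱχ D σ}

/-- Each cutoff factor is non-negative. [formal bookkeeping] -/
private theorem factor_nonneg (i : Fin m) (y : E3) :
    0 ≤ (if σ i then profileWeight ϱχ (D i) y else 1 - profileWeight ϱχ (D i) y) := by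
  split_ifs
  · exact profileWeight_nonneg _ _ _
  · exact sub_nonneg.2 (profileWeight_le_one _ _ _)

/-- Each cutoff factor is at most one. [formal bookkeeping] -/
private theorem factor_le_one (i : Fin m) (y : E3) :
    (if σ i then profileWeight ϱχ (D i) y else 1 - profileWeight ϱχ (D i) y) ≤ 1 := by
  split_ifs
  · exact profileWeight_le_one _ _ _
  · exact sub_le_self _ (profileWeight_nonneg _ _ _)

variable (ϱχ D σ)

/-- The localisation factor is non-negative … -/
theorem localFactor_nonneg (y : E3) : 0 ≤ localFactor ϱχ D σ y :=
  Finset.prod_nonneg fun i _ => factor_nonneg i y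

/-- … and at most `1`. -/
theorem localFactor_le_one (y : E3) : localFactor ϱχ D σ y ≤ 1 :=
  Finset.prod_le_one (fun i _ => factor_nonneg i y) fun i _ => factor_le_one i y

/-- The alive indicator is non-negative … -/
theorem aliveFactor_nonneg (y : E3) : 0 ≤ aliveFactor ϱχ D σ y :=
  Finset.prod_nonneg fun i _ => by
    by_cases h : InTransition ϱχ D i y
    · simp only [h, if_true]; exact zero_le_one
    · simp only [h, if_false]; exact factor_nonneg i y

/-- … at most `1` … -/
theorem aliveFactor_le_one (y : E3) : aliveFactor ϱχ D σ y ≤ 1 :=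
  Finset.prod_le_one
    (fun i _ => by
      by_cases h : InTransition ϱχ D i y
      · simp only [h, if_true]; exact zero_le_one
      · simp only [h, if_false]; exact factor_nonneg i y)
    fun i _ => by
      by_cases h : InTransition ϱχ D i y
      · simp only [h, if_true]; exact le_rfl
      · simp only [h, if_false]; exact factor_le_one i y

/-- … and dominates the localisation factor (a pattern of positive weight at `y` is alive there). -/
theorem localFactor_le_aliveFactor (y : E3) : localFactor ϱχ D σ y ≤ aliveFactor ϱχ D σ y :=
  Finset.prod_le_prod (fun i _ => factor_nonneg i y) fun i _ => by
    by_cases h : InTransition ϱχ D i y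
    · simp only [h, if_true]; exact factor_le_one i y
    · simp only [h, if_false]; exact le_rfl

/-- Degenerate instance (the EMPTY LIST): every localisation factor is `1` … -/
theorem localFactor_fin_zero (D : Fin 0 → Set E3) (σ : Fin 0 → Bool) (y : E3) : localFactor ϱχ D σ y = 1 := by
  simp [localFactor]

/-- … the transition multiplicity is `0` … -/
theorem transMult_fin_zero (D : Fin 0 → Set E3) (y : E3) : transMult ϱχ D y = 0 := by
  simp [transMult]

/-- … and the alive indicator is `1`. -/
theorem aliveFactor_fin_zero (D : Fin 0 → Set E3) (σ : Fin 0 → Bool) (y : E3) : aliveFactor ϱχ D σ y = 1 := by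
  simp [aliveFactor]

/-- Degenerate instance: a listed EMPTY set with sign «far» kills the pattern (`dist(·, ∅) = 0` by the Mathlib convention, so its profile
weight is `0` everywhere) — harmless: all four sums below then vanish for that pattern. -/
theorem localFactor_eq_zero_of_empty {i : Fin m} (hD : D i = ∅) (hσ : σ i = true) (y : E3) : localFactor ϱχ D σ y = 0 := by
  unfold localFactor
  exact Finset.prod_eq_zero (Finset.mem_univ i) (by rw [if_pos hσ, hD, profileWeight_empty])

/-- ★ **PARTITION**: appending one set to the list splits every pattern into its «far» and «near» refinements, whose factors ADD UP to the
parent's — by induction the `2^m` patterns of a list are a partition of unity, and the instances of a reduction may be refined set by set. -/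
theorem localFactor_snoc_add (D' : Set E3) (y : E3) :
    localFactor ϱχ (Fin.snoc (α := fun _ => Set E3) D D') (Fin.snoc (α := fun _ => Bool) σ true) y +
      localFactor ϱχ (Fin.snoc (α := fun _ => Set E3) D D') (Fin.snoc (α := fun _ => Bool) σ false) y = localFactor ϱχ D σ y := by
  simp only [localFactor, Fin.prod_univ_castSucc, Fin.snoc_castSucc, Fin.snoc_last]
  simp only [if_true, Bool.false_eq_true, if_false]
  ring

/-- Each refinement is dominated by its parent. -/
theorem localFactor_snoc_le (D' : Set E3) (b : Bool) (y : E3) :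
    localFactor ϱχ (Fin.snoc (α := fun _ => Set E3) D D') (Fin.snoc (α := fun _ => Bool) σ b) y ≤ localFactor ϱχ D σ y := by
  have h := localFactor_snoc_add ϱχ D σ D' y
  have ht := localFactor_nonneg ϱχ (Fin.snoc (α := fun _ => Set E3) D D') (Fin.snoc (α := fun _ => Bool) σ true) y
  have hf := localFactor_nonneg ϱχ (Fin.snoc (α := fun _ => Set E3) D D') (Fin.snoc (α := fun _ => Bool) σ false) y
  cases b
  · linarith
  · linarith

/-- The **χ-WEIGHTED SHELL MASS**: the sum of the localisation factor over the non-excised motif sites of profile weight strictly between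
`0` and `1` (the currency of `C_T` for the weight `χ·w`; at most the plain model shell count). -/
def shellMassL (P : PeriodicConfiguration 3) (X : Set E3) (ϱ : ℝ) (C : Set E3) : ℝ :=
  ∑ y ∈ P.motif, if y ∉ X ∧ 0 < profileWeight ϱ C y ∧ profileWeight ϱ C y < 1 then localFactor ϱχ D σ y else 0

/-- The **w-WEIGHTED ALIVE TRANSITION MASS** of the pattern: `Σ_{y ∈ motif ∖ X} w_C(y)·alive_σ(y)·mult(y)²` (the currency of `Cχ`). -/
def transMassL (P : PeriodicConfiguration 3) (X : Set E3) (ϱ : ℝ) (C : Set E3) : ℝ :=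
  ∑ y ∈ P.motif, if y ∈ X then 0 else profileWeight ϱ C y * aliveFactor ϱχ D σ y * (transMult ϱχ D y : ℝ) ^ 2

/-- The **LOCALISED NEAR-PRICED EXCISED COUNT**: excised motif sites having a NON-excised reference site of positive LOCALISED weight
`χ·w` within `3ϱ/8` — each instance excises everything farther than `3ϱ/8` from its own support for free. -/
def pricedNearCountL (P : PeriodicConfiguration 3) (X : Set E3) (ϱ : ℝ) (C : Set E3) : ℕ :=
  (P.motif.filter fun y => y ∈ X ∧ ∃ z ∈ P.points, z ∉ X ∧ 0 < localFactor ϱχ D σ z * profileWeight ϱ C z ∧ dist y z < 3 * ϱ / 8).card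

/-- The **LOCALISED MODEL OF THE FAR ACCOUNT**: the P-A model `Σ_{y ∈ motif ∖ X} w_C(y)·(l_y(β) + λ·q_y(β))` with the weights `χ·w`. -/
def modelFarL (β : E3 → E3 → E3) (P : PeriodicConfiguration 3) (X : Set E3) (lamQ ϱ : ℝ) (C : Set E3) : ℝ :=
  ∑ y ∈ P.motif, if y ∈ X then 0 else localFactor ϱχ D σ y * (profileWeight ϱ C y * (linSite β P X y + lamQ * quadSite β P X y))

variable (P : PeriodicConfiguration 3) (X : Set E3) (ϱ : ℝ) (C : Set E3) (β : E3 → E3 → E3) (lamQ : ℝ)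

/-- The χ-weighted shell mass is non-negative … -/
theorem shellMassL_nonneg : 0 ≤ shellMassL ϱχ D σ P X ϱ C :=
  Finset.sum_nonneg fun y _ => by
    split_ifs
    · exact localFactor_nonneg _ _ _ _
    · exact le_rfl

/-- … and at most the plain model shell count (`χ ≤ 1`): the shell price of a localised instance never exceeds the unlocalised one. -/
theorem shellMassL_le_modelShellCount : shellMassL ϱχ D σ P X ϱ C ≤ (modelShellCount P X ϱ C : ℝ) := by
  rw [modelShellCount, Finset.card_filter, Nat.cast_sum]
  refine Finset.sum_le_sum fun y _ => ?_
  split_ifs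
  · simpa using localFactor_le_one ϱχ D σ y
  · simp

/-- The transition mass is non-negative. -/
theorem transMassL_nonneg : 0 ≤ transMassL ϱχ D σ P X ϱ C :=
  Finset.sum_nonneg fun y _ => by
    split_ifs
    · exact le_rfl
    · exact mul_nonneg (mul_nonneg (profileWeight_nonneg _ _ _) (aliveFactor_nonneg _ _ _ _)) (sq_nonneg _)

/-- ★ **LOCALISED ≤ NEAR-PRICED**: a site of positive localised weight has positive profile weight (`χ ≤ 1`), so localising the pricing
only ENLARGES the free set. -/
theorem pricedNearCountL_le : pricedNearCountL ϱχ D σ P X ϱ C ≤ pricedNearCount P X ϱ C := by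
  unfold pricedNearCountL pricedNearCount
  refine Finset.card_le_card fun y hy => ?_
  rw [Finset.mem_filter] at hy ⊢
  obtain ⟨hmem, hyX, z, hz, hzX, hpos, hd⟩ := hy
  refine ⟨hmem, hyX, z, hz, hzX, ?_, hd⟩
  exact lt_of_lt_of_le hpos (mul_le_of_le_one_left (profileWeight_nonneg _ _ _) (localFactor_le_one _ _ _ _))

/-- EMPTY LIST: the χ-weighted shell mass is the model shell count … -/
theorem shellMassL_fin_zero (D : Fin 0 → Set E3) (σ : Fin 0 → Bool) :
    shellMassL ϱχ D σ P X ϱ C = (modelShellCount P X ϱ C : ℝ) := by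
  rw [modelShellCount, Finset.card_filter, Nat.cast_sum]
  refine Finset.sum_congr rfl fun y _ => ?_
  simp only [localFactor_fin_zero]
  split_ifs <;> simp

/-- … the transition mass vanishes … -/
theorem transMassL_fin_zero (D : Fin 0 → Set E3) (σ : Fin 0 → Bool) : transMassL ϱχ D σ P X ϱ C = 0 := by
  refine Finset.sum_eq_zero fun y _ => ?_
  simp [transMult_fin_zero]

/-- … the localised pricing is the near-pricing … -/
theorem pricedNearCountL_fin_zero (D : Fin 0 → Set E3) (σ : Fin 0 → Bool) :
    pricedNearCountL ϱχ D σ P X ϱ C = pricedNearCount P X ϱ C := by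
  simp [pricedNearCountL, pricedNearCount, localFactor_fin_zero]

/-- … and the localised model is the P-A model: (H𝄪) at `m = 0` is (Hˢ) verbatim. -/
theorem modelFarL_fin_zero (D : Fin 0 → Set E3) (σ : Fin 0 → Bool) :
    modelFarL ϱχ D σ β P X lamQ ϱ C = modelFar β P X lamQ ϱ C := by
  simp [modelFarL, modelFar, localFactor_fin_zero]

/-- Degenerate instance: with NO centres (`C = ∅`, profile weight `0` everywhere) the localised model, the χ-weighted shell mass, the
transition mass and the localised pricing all vanish — (H𝄪) then reads `0 ≤ 0`, honest and not vacuous. -/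
theorem local_empty_centres :
    modelFarL ϱχ D σ β P X lamQ ϱ ∅ = 0 ∧ shellMassL ϱχ D σ P X ϱ ∅ = 0 ∧ transMassL ϱχ D σ P X ϱ ∅ = 0 ∧
      pricedNearCountL ϱχ D σ P X ϱ ∅ = 0 := by
  refine ⟨Finset.sum_eq_zero fun y _ => by simp [profileWeight_empty], Finset.sum_eq_zero fun y _ => by simp [profileWeight_empty],
    Finset.sum_eq_zero fun y _ => by simp [profileWeight_empty], ?_⟩
  unfold pricedNearCountL
  rw [Finset.card_eq_zero, Finset.filter_eq_empty_iff]
  rintro y - ⟨-, z, -, -, hpos, -⟩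
  simp [profileWeight_empty] at hpos

end Local

end Summit.AtomisticToContinuum.Crystallization.Theorems.ChargedEnergyGapChartDial

end
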